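import Mathlib
import Literature.AlgebraicGeometry.Resolution.SyzygySheaf
import Summits.ResolutionOfSingularities.ResolutionOfSingularities.Theorems.SyzygyFlatteningHigherRankTerminationMinorFreeSummand
import HarnessLib

/-!
# The flattening ideal of a syzygy module is well defined up to `Kˣ`

Stub `stub_normIdeal_indep` of crux `HigherRankTermination`
(stmt-ResolutionOfSingularities-17045), line `birth`: pure commutative algebra, no tower vocabulary.

Let `R` be a commutative ring whose structure map to a field `K` is injective, `P` an `R`-module
with two resolutions `(b, d, ε)`, `(b', d', ε')` by finite free modules, `n : ℕ`, and
`ι : range (d n) ↪ Rʳ`, `ι' : range (d' n) ↪ R^{r'}` injective linear maps with torsion cokernels.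
Then the `R`-span (inside `K`) of the maximal minors of `ι'` equals `c ·` the `R`-span of the
maximal minors of `ι` for ONE non-zero constant `c ∈ K`.

Proof.
* Generalised Schanuel (`FreeResolution.syzygy_stablyEquiv`): `Ω × Rᵃ ≃ₗ[R] Ω' × R^{b₀}` for
  `Ω = range (d n)`, `Ω' = range (d' n)`.
* The block embedding `κ' (ω', f) = Fin.append (ι' ω') f` of `Ω' × R^{b₀}` into `R^{r' + b₀}` is
  injective with torsion cokernel (`minorFreeSummand_exists_append`, `_append_props`), hence so is
  its transport `κ̃ = κ' ∘ e` to `Ω × Rᵃ`, and the two families of maximal minors of `κ̃` and `κ'`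
  have the same range (tuples correspond under postcomposition with the bijection `e`).
* `stub_minor_freeSummand` twice: `span (minors κ̃) = c₁ · span (minors ι)` and
  `span (minors κ') = c₂ · span (minors ι')`; cancel `c₂`.
-/

noncomputable section

set_option linter.dupNamespace false

namespace Summit.ResolutionOfSingularities.ResolutionOfSingularities.Theorems.SyzygyFlattening

/-- **Cancelling a unit scaling of submodules of a field.** If `c₂ · S' = c₁ · S` as
`R`-submodules of `K` with `c₂ ≠ 0`, then `S' = (c₂⁻¹ c₁) · S`. [folklore] -/
theorem normIdealIndep_map_mulLeft_cancel (R K : Type) [CommRing R] [Field K] [Algebra R K]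
    (S S' : Submodule R K) (c₁ c₂ : K) (hc₂ : c₂ ≠ 0)
    (H : S'.map (LinearMap.mulLeft R c₂) = S.map (LinearMap.mulLeft R c₁)) :
    S' = S.map (LinearMap.mulLeft R (c₂⁻¹ * c₁)) := by
  calc S' = (S'.map (LinearMap.mulLeft R c₂)).map (LinearMap.mulLeft R c₂⁻¹) := by
        rw [← Submodule.map_comp, ← LinearMap.mulLeft_mul, inv_mul_cancel₀ hc₂,
          LinearMap.mulLeft_one, Submodule.map_id]
    _ = (S.map (LinearMap.mulLeft R c₁)).map (LinearMap.mulLeft R c₂⁻¹) := by rw [H]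
    _ = S.map (LinearMap.mulLeft R (c₂⁻¹ * c₁)) := by
        rw [← Submodule.map_comp, ← LinearMap.mulLeft_mul]

/-- **Transport of an embedding along a linear equivalence.** If `κ' : N' →ₗ[R] (Fin t → R)` is
injective with torsion cokernel and `e : N ≃ₗ[R] N'`, then `κ' ∘ e` is injective with torsion
cokernel, and the maximal minors of `κ' ∘ e` on `t`-tuples of `N` and of `κ'` on `t`-tuples of
`N'` have the same range in `K`. [folklore] -/
theorem normIdealIndep_transport (R K : Type) [CommRing R] [Field K] [Algebra R K]
    (N N' : Type) [AddCommGroup N] [Module R N] [AddCommGroup N'] [Module R N'] (t : ℕ)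
    (e : N ≃ₗ[R] N') (κ' : N' →ₗ[R] (Fin t → R)) (hκ' : Function.Injective κ')
    (hT' : ∀ z : Fin t → R, ∃ a : R, a ≠ 0 ∧ a • z ∈ LinearMap.range κ') :
    Function.Injective (κ' ∘ₗ e.toLinearMap) ∧
      (∀ z : Fin t → R, ∃ a : R, a ≠ 0 ∧ a • z ∈ LinearMap.range (κ' ∘ₗ e.toLinearMap)) ∧
      Set.range (fun g : Fin t → N =>
          Matrix.det (Matrix.of fun i j => algebraMap R K ((κ' ∘ₗ e.toLinearMap) (g i) j))) =
        Set.range (fun g' : Fin t → N' =>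
          Matrix.det (Matrix.of fun i j => algebraMap R K (κ' (g' i) j))) := by
  refine ⟨?_, ?_, ?_⟩
  · rw [LinearMap.coe_comp, LinearEquiv.coe_coe]
    exact hκ'.comp e.injective
  · intro z
    obtain ⟨a, ha, p, hp⟩ := hT' z
    exact ⟨a, ha, e.symm p, by rw [← hp, LinearMap.comp_apply, LinearEquiv.coe_coe,
      LinearEquiv.apply_symm_apply]⟩
  · have hfun : (fun g : Fin t → N =>
        Matrix.det (Matrix.of fun i j => algebraMap R K ((κ' ∘ₗ e.toLinearMap) (g i) j))) =
        (fun g' : Fin t → N' =>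
          Matrix.det (Matrix.of fun i j => algebraMap R K (κ' (g' i) j))) ∘ (⇑e ∘ ·) := by
      funext g
      simp only [Function.comp_apply, LinearMap.comp_apply, LinearEquiv.coe_coe]
    rw [hfun, e.surjective.comp_left.range_comp]

/-- **STUB `stub_normIdeal_indep`.** The ideal of maximal minors of an embedding (injective,
torsion cokernel) of the `(n+1)`-st syzygy module of a resolution of `P` by finite free modules is
independent of the resolution and of the embedding up to ONE constant `c ∈ Kˣ`:
`span (minors ι') = c · span (minors ι)` as `R`-submodules of `K` (generalised Schanuel
`Ω × Rᵃ ≃ Ω' × R^{b₀}`, then `stub_minor_freeSummand` for the block embeddings of both sides into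
the common `R^{r' + b₀}`). [cite: Matsumura1987, §19 Lemma 4] -/
theorem stub_normIdeal_indep : ∀ (R K : Type) [CommRing R] [Field K] [Algebra R K],
    Function.Injective (algebraMap R K) →
    ∀ (P : Type) [AddCommGroup P] [Module R P]
      (b : ℕ → ℕ) (d : (i : ℕ) → ((Fin (b (i + 1)) → R) →ₗ[R] (Fin (b i) → R)))
      (ε : (Fin (b 0) → R) →ₗ[R] P)
      (b' : ℕ → ℕ) (d' : (i : ℕ) → ((Fin (b' (i + 1)) → R) →ₗ[R] (Fin (b' i) → R)))
      (ε' : (Fin (b' 0) → R) →ₗ[R] P),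
      Function.Surjective ε → Function.Exact (d 0) ε → (∀ i : ℕ, Function.Exact (d (i + 1)) (d i)) →
      Function.Surjective ε' → Function.Exact (d' 0) ε' →
      (∀ i : ℕ, Function.Exact (d' (i + 1)) (d' i)) →
      ∀ (n r r' : ℕ) (ι : ↥(LinearMap.range (d n)) →ₗ[R] (Fin r → R))
        (ι' : ↥(LinearMap.range (d' n)) →ₗ[R] (Fin r' → R)),
        Function.Injective ι → Function.Injective ι' →
        (∀ z : Fin r → R, ∃ a : R, a ≠ 0 ∧ a • z ∈ LinearMap.range ι) →
        (∀ z : Fin r' → R, ∃ a : R, a ≠ 0 ∧ a • z ∈ LinearMap.range ι') →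
        ∃ c : K, c ≠ 0 ∧
          Submodule.span R (Set.range fun g' : Fin r' → ↥(LinearMap.range (d' n)) =>
              Matrix.det (Matrix.of fun i j => algebraMap R K (ι' (g' i) j))) =
            (Submodule.span R (Set.range fun g : Fin r → ↥(LinearMap.range (d n)) =>
              Matrix.det (Matrix.of fun i j => algebraMap R K (ι (g i) j)))).map
              (LinearMap.mulLeft R c) := by
  intro R K _ _ _ hRK P _ _ b d ε b' d' ε' hε h₀ hs hε' h₀' hs' n r r' ι ι' hι hι' htor htor'
  classical
  -- generalised Schanuel: `Ω × Rᵃ ≃ Ω' × R^{b₀}`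
  obtain ⟨a, b₀, ⟨e⟩⟩ : ∃ a b₀ : ℕ, Nonempty ((↥(LinearMap.range (d n)) × (Fin a → R)) ≃ₗ[R]
      (↥(LinearMap.range (d' n)) × (Fin b₀ → R))) :=
    Literature.AlgebraicGeometry.Resolution.FreeResolution.syzygy_stablyEquiv
      ⟨b, d, ε, hε, h₀, hs⟩ ⟨b', d', ε', hε', h₀', hs'⟩ n
  -- the block embedding `κ'` of `Ω' × R^{b₀}` into `R^{r' + b₀}` and its transport `κ' ∘ e`
  obtain ⟨κ', hκ'⟩ := minorFreeSummand_exists_append R ↥(LinearMap.range (d' n)) r' b₀ ι'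
  obtain ⟨hκ'inj, hκ'tor⟩ :=
    minorFreeSummand_append_props R ↥(LinearMap.range (d' n)) r' b₀ ι' hι' htor' κ' hκ'
  obtain ⟨hκinj, hκtor, hrange⟩ :=
    normIdealIndep_transport R K _ _ (r' + b₀) e κ' hκ'inj hκ'tor
  -- `stub_minor_freeSummand` on both sides
  obtain ⟨c₁, hc₁, h₁⟩ := stub_minor_freeSummand R K hRK ↥(LinearMap.range (d n)) r a (r' + b₀)
    ι (κ' ∘ₗ e.toLinearMap) hι hκinj htor hκtor
  obtain ⟨c₂, hc₂, h₂⟩ := stub_minor_freeSummand R K hRK ↥(LinearMap.range (d' n)) r' b₀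
    (r' + b₀) ι' κ' hι' hκ'inj htor' hκ'tor
  refine ⟨c₂⁻¹ * c₁, mul_ne_zero (inv_ne_zero hc₂) hc₁, ?_⟩
  apply normIdealIndep_map_mulLeft_cancel R K _ _ c₁ c₂ hc₂
  rw [← h₂, ← h₁, hrange]

end Summit.ResolutionOfSingularities.ResolutionOfSingularities.Theorems.SyzygyFlattening

end
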